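import Mathlib.Analysis.Calculus.BumpFunction.FiniteDimension
import Mathlib.Analysis.InnerProductSpace.Calculus
import Mathlib.Geometry.Manifold.MFDeriv.FDeriv
import Mathlib.Geometry.Manifold.MFDeriv.SpecificFunctions
import Mathlib.Geometry.Manifold.ContMDiff.NormedSpace
import Literature.Topology.FourManifolds.SliceGenus
import HarnessLib

/-!
# Discharge of `HasSeifertSurfaceOfGenus.hasSliceSurfaceOfGenus`: push a Seifert surface into `B⁴`

Sibling proof file of `Literature/Topology/FourManifolds/SliceGenus.lean`, proving its named
fact `Literature.Topology.FourManifolds.Knot.HasSeifertSurfaceOfGenus.hasSliceSurfaceOfGenus`: a Seifert surface of genus `g`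
for a knot `K` (a compact connected orientable surface `S` with one boundary circle, smoothly
embedded in `𝕊³ ⊆ ℝ⁴` with boundary `K`) yields a slice surface of genus `g` (the same abstract
surface, smoothly embedded in the closed unit ball with boundary `K` and interior in the open
ball `B⁴`).  This is the remark `g₄(K) ≤ g₃(K)` of Livingston's survey — the 4–ball genus "is
clearly bounded by its 3–sphere genus" (Livingston 2005, §9.5) — obtained, in his words, by
"push[ing] a Seifert surface `F` for `K` into `B⁴`" (loc. cit., §9.1).  The source gives no
further detail; the radial push below is the standard argument.

## Proof

Let `F : S → ℝ⁴`, `‖F‖ ≡ 1`, be the Seifert embedding and `C = K(𝕊¹) ⊆ ℝ⁴` the (compact) knot.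
Since `F` is injective and `F|∂S = K ∘ e` with `e : ∂S ≃ 𝕊¹`, we have `F⁻¹(C) = ∂S`.  Choose
(`IsOpen.exists_contDiff_support_eq`) a smooth `f : ℝ⁴ → [0, 1]` with `support f = Cᶜ`, put
`ρ = 1 - f/2 : ℝ⁴ → [1/2, 1]` and push radially: `F' x = ρ(F x) • F x`.  Then
`‖F' x‖ = ρ(F x)` equals `1` exactly on `∂S` and is `< 1` on the interior
(`ModelWithCorners.compl_boundary`); `F' = F = K ∘ e` on `∂S`; `F'` is smooth
(`ContDiff.comp_contMDiff`) and injective (compare norms, then cancel `ρ`).  For the immersion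
property (`Knot.SeifertPush.injective_mfderiv_smul`): `d(ρ • id)_y(w) = ρ(y) w + dρ_y(w) y`,
and `dF_x(v) ⊥ F(x)` because `‖F‖² ≡ 1` (`Knot.SeifertPush.inner_mfderiv_eq_zero_of_norm_eq`:
chain rule and uniqueness of the manifold derivative); so if `dF'_x` identifies two tangent
vectors, the difference `u` of their images under `dF_x` satisfies `ρ u + dρ(u) F(x) = 0` with
`u ⊥ F(x)`, forcing `dρ(u) = 0` and then `u = 0`
(`Knot.SeifertPush.eq_zero_of_smul_add_smul_eq_zero`), whence the two vectors agree by
injectivity of `dF_x`.  Orientability of `S` and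
`rank H₁(S; ℤ) = 2g` are properties of `S` alone and carry over verbatim.

## References

* C. Livingston, *A survey of classical knot concordance*, in: Handbook of knot theory,
  Elsevier (2005), 319–347 = arXiv:math/0307077: §9.5 "Genus" (arXiv p. 14: `g₄(K)` "is a
  concordance invariant of a knot which is clearly bounded by its 3–sphere genus") and §9.1
  (arXiv p. 12: "Push a Seifert surface `F` for `K` into `B⁴`") [Livingston2005].
* Mathlib: `IsOpen.exists_contDiff_support_eq` (smooth functions with prescribed open support),
  `HasMFDerivAt.comp`, `hasMFDerivAt_unique`, `hasStrictFDerivAt_norm_sq`, `HasFDerivAt.smul`,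
  `ModelWithCorners.compl_boundary`.
-/

open scoped Manifold ContDiff Topology
open Function Set

noncomputable section

namespace Literature.Topology.FourManifolds

/-! ## The radial push of an immersion into a sphere

General calculus lemmas used by the discharge below: for a differentiable map `F : M → V` from
a manifold into a real inner product space with `‖F‖` constant, tangent vectors are orthogonal
to the position vector, and the radial rescaling `x ↦ ρ(F x) • F x` (with `ρ(F x) ≠ 0`) of an
immersion into the unit sphere is again an immersion. -/

namespace Knot.SeifertPush

variable {EM : Type*} [NormedAddCommGroup EM] [NormedSpace ℝ EM] {HM : Type*}
  [TopologicalSpace HM] {I : ModelWithCorners ℝ EM HM} {M : Type*} [TopologicalSpace M]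
  [ChartedSpace HM M] {V : Type*} [NormedAddCommGroup V] [InnerProductSpace ℝ V]

/-- If `F : M → V` has constant norm, then `dF_x v ⊥ F x` for every tangent vector `v`
(differentiate `‖F‖² = c²`). [folklore] -/
theorem inner_mfderiv_eq_zero_of_norm_eq {F : M → V} {x : M}
    (hF : MDifferentiableAt I 𝓘(ℝ, V) F x) {c : ℝ} (hnorm : ∀ y, ‖F y‖ = c)
    (v : TangentSpace I x) :
    inner ℝ (F x) ((mfderiv I 𝓘(ℝ, V) F x v : TangentSpace 𝓘(ℝ, V) (F x)) : V) = 0 := by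
  have hFx := hF.hasMFDerivAt
  have hN : HasMFDerivAt I 𝓘(ℝ, ℝ) ((fun y : V => ‖y‖ ^ 2) ∘ F) x
      ((2 • innerSL ℝ (F x)).comp (mfderiv I 𝓘(ℝ, V) F x)) :=
    (hasStrictFDerivAt_norm_sq (F x)).hasFDerivAt.hasMFDerivAt.comp x hFx
  have hconst : ((fun y : V => ‖y‖ ^ 2) ∘ F) = fun _ => c ^ 2 := by
    funext y
    simp [hnorm y]
  rw [hconst] at hN
  have h0 := hasMFDerivAt_unique hN (hasMFDerivAt_const (I := I) (I' := 𝓘(ℝ, ℝ)) (c ^ 2) x)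
  have h0v : (2 • innerSL ℝ (F x)) ((mfderiv I 𝓘(ℝ, V) F x v : TangentSpace 𝓘(ℝ, V) (F x)) : V)
      = 0 := DFunLike.congr_fun h0 v
  rw [smul_apply, innerSL_apply_apply, smul_eq_zero] at h0v
  exact h0v.resolve_left two_ne_zero

/-- Linear algebra of the radial push: if `‖p‖ = 1`, `u ⊥ p`, `r ≠ 0` and
`r • u + (L u) • p = 0`, then `u = 0`. [folklore] -/
theorem eq_zero_of_smul_add_smul_eq_zero {p u : V} (hp : ‖p‖ = 1) (hu : inner ℝ p u = 0)
    {r : ℝ} (hr : r ≠ 0) (L : V →L[ℝ] ℝ) (h : r • u + (L u) • p = 0) : u = 0 := by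
  have h1 : L u = 0 := by
    have h2 := congrArg (fun w : V => inner ℝ p w) h
    simpa [inner_add_right, real_inner_smul_right, hu, real_inner_self_eq_norm_sq, hp] using h2
  rw [h1, zero_smul, add_zero] at h
  exact (smul_eq_zero.mp h).resolve_left hr

/-- The radial push `x ↦ ρ(F x) • F x` of an immersion `F : M → V` into the unit sphere of `V`
along a differentiable function `ρ` with `ρ (F x) ≠ 0` is an immersion at `x`. [folklore] -/
theorem injective_mfderiv_smul {F : M → V} {x : M} (hF : MDifferentiableAt I 𝓘(ℝ, V) F x)
    (hnorm : ∀ y, ‖F y‖ = 1) (himm : Injective (mfderiv I 𝓘(ℝ, V) F x)) {ρ : V → ℝ}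
    (hρ : DifferentiableAt ℝ ρ (F x)) (hρpos : ρ (F x) ≠ 0) :
    Injective (mfderiv I 𝓘(ℝ, V) (fun y => ρ (F y) • F y) x) := by
  set D : TangentSpace I x →L[ℝ] V := mfderiv I 𝓘(ℝ, V) F x
  have hFx : HasMFDerivAt I 𝓘(ℝ, V) F x D := hF.hasMFDerivAt
  set L : V →L[ℝ] ℝ := fderiv ℝ ρ (F x)
  have hΦd : HasFDerivAt (fun z : V => ρ z • z)
      (ρ (F x) • ContinuousLinearMap.id ℝ V + L.smulRight (F x)) (F x) :=
    hρ.hasFDerivAt.smul (hasFDerivAt_id (F x))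
  have hcomp : HasMFDerivAt I 𝓘(ℝ, V) (fun y => ρ (F y) • F y) x
      ((ρ (F x) • ContinuousLinearMap.id ℝ V + L.smulRight (F x)).comp D) :=
    hΦd.hasMFDerivAt.comp x hFx
  rw [hcomp.mfderiv]
  intro v w hvw
  apply himm
  have h0 : ρ (F x) • D v + (L (D v)) • F x = ρ (F x) • D w + (L (D w)) • F x := hvw
  have h1 : ρ (F x) • (D v - D w) + (L (D v - D w)) • F x = 0 := by
    rw [map_sub, smul_sub, sub_smul, ← sub_eq_zero.2 h0]
    abel
  have h2 := eq_zero_of_smul_add_smul_eq_zero (hnorm x) ?_ hρpos L h1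
  · exact sub_eq_zero.1 h2
  · have hv : inner ℝ (F x) (D v) = 0 := inner_mfderiv_eq_zero_of_norm_eq hF hnorm v
    have hw : inner ℝ (F x) (D w) = 0 := inner_mfderiv_eq_zero_of_norm_eq hF hnorm w
    rw [inner_sub_right, hv, hw, sub_zero]

end Knot.SeifertPush

/-! ## The discharge

(The model spaces are written out in full — `EuclideanSpace ℝ (Fin 4)` for `ℝ⁴`,
`Metric.sphere (0 : EuclideanSpace ℝ (Fin (n + 1))) 1` for `𝕊ⁿ` — rather than through the
file-local notations `𝔼`/`𝕊` of `SliceGenus.lean`, which do not cross the import.) -/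

namespace Knot

/-- **Discharge of the named fact `Knot.HasSeifertSurfaceOfGenus.hasSliceSurfaceOfGenus`**
(pushing a Seifert surface into the 4-ball): a Seifert surface `F : S → 𝕊³` of genus `g` for
`K`, pushed radially to `x ↦ ρ(F x) • F x` along `ρ = 1 - f/2`, where `f : ℝ⁴ → [0, 1]` is
smooth with zero set exactly the knot `K(𝕊¹)` (`IsOpen.exists_contDiff_support_eq`), is a
slice surface of genus `g`: the pushed map is again a smooth injective immersion
(`Knot.SeifertPush.injective_mfderiv_smul`, using `dF_x v ⊥ F x` from `‖F‖ ≡ 1`), agrees with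
`K ∘ e` on `∂S = F⁻¹(K(𝕊¹))`, and has norm `ρ ∘ F < 1` on the interior.
Livingston (2005), §9.5 (`g₄` "is clearly bounded by its 3–sphere genus"), §9.1 ("push a
Seifert surface `F` for `K` into `B⁴`"). [cite: Livingston2005, §9.5] -/
theorem HasSeifertSurfaceOfGenus.hasSliceSurfaceOfGenus_holds :
    HasSeifertSurfaceOfGenus.hasSliceSurfaceOfGenus := by
  intro K g h
  obtain ⟨S, i₁, i₂, i₃, i₄, i₅, i₆, i₇, F, e, ⟨hor, hF, hinj, himm, hbd, hrank⟩, hnorm⟩ := h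
  -- the knot as a compact subset `C` of `ℝ⁴`, and `F ⁻¹' C = ∂S`
  set C : Set (EuclideanSpace ℝ (Fin 4)) :=
    range fun z : Metric.sphere (0 : EuclideanSpace ℝ (Fin (1 + 1))) 1 =>
      ((K z : Metric.sphere (0 : EuclideanSpace ℝ (Fin (3 + 1))) 1) : EuclideanSpace ℝ (Fin 4))
  have hC : IsCompact C := isCompact_range (continuous_subtype_val.comp K.continuous)
  have hmemC : ∀ x : S, F x ∈ C ↔ x ∈ (𝓡∂ 2).boundary S := by
    intro x
    constructor
    · rintro ⟨z, hz⟩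
      dsimp only at hz
      have hx' : F (e.symm z : S) = F x := by
        rw [hbd (e.symm z), e.apply_symm_apply, hz]
      rw [← hinj hx']
      exact (e.symm z).2
    · intro hx
      exact ⟨e ⟨x, hx⟩, (hbd ⟨x, hx⟩).symm⟩
  -- a smooth `f : ℝ⁴ → [0, 1]` vanishing exactly on the knot, and `ρ = 1 - f / 2`
  obtain ⟨f, hfsupp, hfsm, hf01⟩ := hC.isClosed.isOpen_compl.exists_contDiff_support_eq (n := ⊤)
  have hf0 : ∀ y, f y = 0 ↔ y ∈ C := fun y => by
    have h1 : y ∈ support f ↔ y ∈ Cᶜ := by rw [hfsupp]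
    simpa only [mem_support, ne_eq, mem_compl_iff, not_iff_not] using h1
  have hf01' : ∀ y, 0 ≤ f y ∧ f y ≤ 1 := fun y => hf01 ⟨y, rfl⟩
  set ρ : EuclideanSpace ℝ (Fin 4) → ℝ := fun y => 1 - 2⁻¹ * f y with hρ_def
  have hρpos : ∀ y, 0 < ρ y := fun y => by
    have := (hf01' y).2; simp only [hρ_def]; linarith
  have hρle : ∀ y, ρ y ≤ 1 := fun y => by
    have := (hf01' y).1; simp only [hρ_def]; linarith
  have hρ1 : ∀ y, ρ y = 1 ↔ y ∈ C := fun y => by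
    rw [← hf0 y, hρ_def]
    constructor <;> intro h <;> linarith
  have hρsm : ContDiff ℝ ∞ ρ := contDiff_const.sub (contDiff_const.mul hfsm)
  have hn : (∞ : WithTop ℕ∞) ≠ 0 := by simp
  -- the pushed surface `F' x = ρ (F x) • F x`
  set F' : S → EuclideanSpace ℝ (Fin 4) := fun x => ρ (F x) • F x with hF'_def
  have hF'sm : ContMDiff (𝓡∂ 2) 𝓘(ℝ, EuclideanSpace ℝ (Fin 4)) ∞ F' :=
    (hρsm.smul contDiff_id).comp_contMDiff hF
  have hnormF' : ∀ x, ‖F' x‖ = ρ (F x) := fun x => by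
    rw [hF'_def, norm_smul, Real.norm_eq_abs, abs_of_pos (hρpos _), hnorm x, mul_one]
  refine ⟨S, i₁, i₂, i₃, i₄, i₅, i₆, i₇, F', e, ⟨hor, hF'sm, ?_, ?_, ?_, hrank⟩, ?_⟩
  · -- `F'` is injective: compare norms, then cancel `ρ`
    intro x y hxy
    have h1 : ρ (F x) = ρ (F y) := by rw [← hnormF' x, ← hnormF' y, hxy]
    have h3 : ρ (F x) • F x = ρ (F y) • F y := hxy
    have h2 : ρ (F x) • F x = ρ (F x) • F y := by rw [h3, h1]
    exact hinj (smul_right_injective (EuclideanSpace ℝ (Fin 4)) (hρpos _).ne' h2)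
  · -- `F'` is an immersion
    intro x
    exact SeifertPush.injective_mfderiv_smul (hF.mdifferentiableAt hn) hnorm (himm x)
      ((hρsm.differentiable hn) (F x)) (hρpos _).ne'
  · -- `F' = K ∘ e` on `∂S`
    intro x
    rw [hF'_def]
    dsimp only
    rw [(hρ1 _).2 ((hmemC x).2 x.2), one_smul]
    exact hbd x
  · -- the interior is pushed into the open ball
    intro x hx
    rw [← ModelWithCorners.compl_boundary, mem_compl_iff, ← hmemC, ← hρ1] at hx
    rw [hnormF']
    exact lt_of_le_of_ne (hρle _) hx

end Knot

end Literature.Topology.FourManifolds
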